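import Mathlib.RingTheory.Ideal.Height
import Mathlib.RingTheory.Ideal.MinimalPrime.Basic
import Mathlib.Algebra.MvPolynomial.PDeriv
import Mathlib.FieldTheory.IsAlgClosed.AlgebraicClosure
import Literature.Computability.AlgebraicComplexity.LandsbergRessayreNormalForm
import HarnessLib

/-!
# von zur Gathen 1987, Thm. 3.1 (regularity of determinantal representations of `perm_m`):
# reduction to the two dimension counts of its printed proof

Topic `Literature/Computability/AlgebraicComplexity`.  The named fact
`vonzurGathen1987_perm_detRepr_rank` (`LandsbergRessayreNormalForm.lean`; von zur Gathen 1987,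
Thm. 3.1: if `per_m = det ∘ Ã` for a polynomial map `Ã : F^{m×m} → F^{n×n}`, `m ≥ 3`, `F` infinite
of characteristic `≠ 2`, then `rank Ã(v) ≥ n - 1` at every point `v`) is the single
non-elementary input of the tree's proof of Landsberg–Ressayre's Thm. 2.8
(`lr_left_equivariant_lower`).  Its printed proof (vzG87 p. 94) has three steps:

1. (algebra) `∂ per/∂x_ij (a) = Σ_kl (∂ det/∂y_kl)(Ã(a)) · (∂ Ã_kl/∂x_ij)(a)`, and
   `∂ det/∂y_kl = ±` an `(n-1)`-minor, so `S := Ã⁻¹(sing D_n) ⊆ sing P_m`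
   (`sing D_n = {rank ≤ n - 2}` is cut out by the `(n-1)`-minors, `sing P_m` by `per_m` and its
   partials);
2. (dimension of fibres + vzG Lemma 2.1: `sing D_n` is irreducible of dimension `n² - 4`)
   if `S ≠ ∅` then `dim S ≥ m² - 4`;
3. (vzG Lemma 2.3) every irreducible component of `sing P_m` has dimension `≤ m² - 5` (`m ≥ 3`),
   so `S = ∅`; finally base change from `F` to an algebraic closure.

This file PROVES step 1 and the final assembly (including the base change), and vendors steps 2
and 3 — the two genuinely dimension-theoretic statements — as NAMED FACTS in the language of
heights of prime ideals of the polynomial ring (`Ideal.height`, `Ideal.minimalPrimes`), via the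
standard dictionary for an algebraically closed field `K` and an ideal `J ⊆ K[x_1, …, x_N]`:
irreducible components of `V(J)` ↔ minimal primes `P` of `J` (Nullstellensatz), and
`dim V(P) = N - height P` (dimension formula for affine domains); `V(J) ≠ ∅ ↔ J ≠ ⊤`.

* `adjIdeal M`: the ideal generated by the entries of `adjugate M` (= the signed `(n-1)`-minors,
  vzG §2: `sing D_n = {a : ∀ i j, det a(i|j) = 0}`);
* `singPermIdeal K m`: the ideal generated by `per_m` and its `m²` partial derivatives
  (vzG §2: `sing P_m`);
* PROVED (step 1): `derivation_det` (a derivation of a determinant is the sum of the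
  determinants with one row derived), `det_updateRow_eq_sum_mul_adjugate`, hence
  `derivation_det_mem_adjIdeal`, `det_mem_adjIdeal`, `singPermIdeal_le_adjIdeal`;
  and `adjugate_eq_zero_of_rank_lt` (`rank a ≤ n - 2 ⇒ adj a = 0`);
* NAMED FACT `vonzurGathen1987_submaximalMinors_height` (step 2, height form): over an
  algebraically closed field, if the `(n-1)`-minors of an `n × n` matrix of polynomials (`n ≥ 2`)
  generate a proper ideal, some minimal prime over it has height `≤ 4`;
* NAMED FACT `vonzurGathen1987_singPerm_height` (step 3 = vzG Lemma 2.3, height form): over an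
  algebraically closed field of characteristic `≠ 2`, `m ≥ 3`, every prime containing
  `singPermIdeal K m` has height `≥ 5`;
* PROVED (assembly): `vonzurGathen1987_perm_detRepr_rank_of_height_facts : fact 2 → fact 3 →
  vonzurGathen1987_perm_detRepr_rank`.

Hence `lr_left_equivariant_lower` is reduced to these two height statements (plus the files of
the LR28 chain).  Both facts are classical commutative algebra: fact 2 is the case `t = n - 1` of
the Eagon–Northcott height bound for determinantal ideals, fact 3 is von zur Gathen's explicit
induction; neither is in Mathlib at the time of writing (Krull's height theorem is:
`Mathlib.RingTheory.Ideal.KrullsHeightTheorem`).  Fact 2 is now PROVED in the sibling file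
`VonZurGathenRegularityProofs.lean` (`vonzurGathen1987_submaximalMinors_height_holds`, via
Eagon's theorem for submaximal minors over any noetherian ring, Matsumura CRT Thm. 13.10); fact 3
remains a named fact.

## References

* J. von zur Gathen, *Permanent and determinant*, Linear Algebra Appl. 96 (1987) 87–100:
  §2 (definition of `sing`, `sing D_n`, `sing P_n`), Lemma 2.1, Lemma 2.3, Thm. 3.1 and its
  proof (p. 94).
* J. M. Landsberg, N. Ressayre, *Permanent v. determinant: an exponential lower bound assuming
  symmetry and a potential path towards Valiant's conjecture*, Differential Geom. Appl. 55 (2017)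
  146–166, arXiv:1508.05788: Lemma 3.2 (quotes vzG: `codim (sing P_m) ≥ 5 ⇒` regularity).
-/

noncomputable section

open Matrix MvPolynomial

namespace Literature.Computability.AlgebraicComplexity

namespace VonZurGathen

/-! ### Step 1a: derivations of determinants -/

section Derivation

variable {R : Type*} {A : Type*} [CommRing R] [CommRing A] [Algebra R A]

/-- Product rule for a derivation over a finite product:
`D (∏_{i ∈ s} f i) = Σ_{i ∈ s} (∏_{j ∈ s, j ≠ i} f j) · D (f i)`. [folklore] -/
theorem derivation_prod {ι : Type*} [DecidableEq ι] (D : Derivation R A A) (s : Finset ι)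
    (f : ι → A) : D (∏ i ∈ s, f i) = ∑ i ∈ s, (∏ j ∈ s.erase i, f j) * D (f i) := by
  induction s using Finset.induction_on with
  | empty => simp
  | insert a s ha ih =>
    rw [Finset.prod_insert ha, D.leibniz, ih, Finset.sum_insert ha, Finset.erase_insert ha,
      smul_eq_mul, smul_eq_mul, add_comm, Finset.mul_sum]
    congr 1
    refine Finset.sum_congr rfl fun i hi => ?_
    have hia : a ≠ i := fun h => ha (h ▸ hi)
    rw [Finset.erase_insert_of_ne hia,
      Finset.prod_insert fun h => ha (Finset.mem_of_mem_erase h)]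
    ring

/-- **Derivative of a determinant, row by row** (vzG87 p. 93, the chain-rule display, in
coordinate-free form): for every derivation `D` of a commutative algebra and every square matrix
`M`, `D (det M) = Σ_r det (M with row r replaced by D (row r))`. [cite: Vonzurgathen1987, proof of Thm. 3.1] -/
theorem derivation_det {n : Type*} [Fintype n] [DecidableEq n] (D : Derivation R A A)
    (M : Matrix n n A) : D M.det = ∑ r, (M.updateRow r fun c => D (M r c)).det := by
  have key : ∀ σ : Equiv.Perm n, D (∏ i, M (σ i) i) =
      ∑ r, ∏ i, (M.updateRow r fun c => D (M r c)) (σ i) i := by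
    intro σ
    rw [derivation_prod]
    refine Finset.sum_equiv σ (fun _ => by simp) fun c _ => ?_
    have hfun : (fun i => (M.updateRow (σ c) fun c' => D (M (σ c) c')) (σ i) i) =
        Function.update (fun i => M (σ i) i) c (D (M (σ c) c)) := by
      funext i
      by_cases h : i = c
      · subst h; simp [Matrix.updateRow_apply]
      · have h' : σ i ≠ σ c := fun e => h (σ.injective e)
        simp [Matrix.updateRow_apply, h, h']
    rw [show (∏ i, (M.updateRow (σ c) fun c' => D (M (σ c) c')) (σ i) i) =
        ∏ i, Function.update (fun i => M (σ i) i) c (D (M (σ c) c)) i from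
        Finset.prod_congr rfl fun i _ => congrFun hfun i,
      Finset.prod_update_of_mem (Finset.mem_univ c), Finset.sdiff_singleton_eq_erase, mul_comm]
  calc D M.det = ∑ σ : Equiv.Perm n, Equiv.Perm.sign σ • D (∏ i, M (σ i) i) := by
        rw [Matrix.det_apply, map_sum]
        refine Finset.sum_congr rfl fun σ _ => ?_
        rw [Units.smul_def, Units.smul_def, map_zsmul]
    _ = ∑ σ : Equiv.Perm n, Equiv.Perm.sign σ •
          ∑ r, ∏ i, (M.updateRow r fun c => D (M r c)) (σ i) i := by simp_rw [key]
    _ = ∑ r, (M.updateRow r fun c => D (M r c)).det := by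
        simp_rw [Matrix.det_apply, Finset.smul_sum]
        exact Finset.sum_comm

end Derivation

/-! ### Step 1b: the ideal of submaximal minors -/

section AdjIdeal

variable {ι : Type*} [Fintype ι] [DecidableEq ι] {S : Type*} [CommRing S]

/-- The ideal `I_{n-1}(M)` generated by the entries of the adjugate of `M`, i.e. by the signed
`(n-1) × (n-1)` minors; its zero set (for `M` the generic matrix) is vzG's
`sing D_n = {a : ∀ i j, det a(i|j) = 0} = {a : rank a ≤ n - 2}`. [cite: Vonzurgathen1987, §2] -/
def adjIdeal (M : Matrix ι ι S) : Ideal S :=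
  Ideal.span (Set.range fun p : ι × ι => M.adjugate p.1 p.2)

/-- Generators. [cite: Vonzurgathen1987, §2] -/
theorem adjugate_mem_adjIdeal (M : Matrix ι ι S) (i j : ι) : M.adjugate i j ∈ adjIdeal M :=
  Ideal.subset_span ⟨(i, j), rfl⟩

/-- Row expansion of a determinant with one row replaced:
`det (M with row r := w) = Σ_c w_c · adj(M)_{c r}`. [folklore] -/
theorem det_updateRow_eq_sum_mul_adjugate (M : Matrix ι ι S) (r : ι) (w : ι → S) :
    (M.updateRow r w).det = ∑ c, w c * M.adjugate c r := by
  rw [← Matrix.cramer_transpose_apply, Matrix.cramer_eq_adjugate_mulVec, Matrix.mulVec,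
    dotProduct]
  refine Finset.sum_congr rfl fun c _ => ?_
  rw [← Matrix.adjugate_transpose, Matrix.transpose_apply, mul_comm]

/-- `det M ∈ I_{n-1}(M)` (Laplace expansion; `n ≥ 1`). [folklore] -/
theorem det_mem_adjIdeal [Nonempty ι] (M : Matrix ι ι S) : M.det ∈ adjIdeal M := by
  obtain ⟨i⟩ := ‹Nonempty ι›
  rw [Matrix.det_eq_sum_mul_adjugate_row M i]
  exact Ideal.sum_mem _ fun j _ => Ideal.mul_mem_left _ _ (adjugate_mem_adjIdeal M j i)

/-- **Step 1 of vzG's proof** (p. 93–94, the chain rule `∂(det ∘ Ã)/∂x_ij =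
Σ_kl (∂ det/∂y_kl)(Ã) ∂Ã_kl/∂x_ij` with `∂ det/∂y_kl = ± det y(k|l)`), ideal-theoretically: every
derivation of `det M` lies in the ideal of the `(n-1)`-minors of `M`. [cite: Vonzurgathen1987, proof of Thm. 3.1] -/
theorem derivation_det_mem_adjIdeal {R : Type*} [CommRing R] [Algebra R S] (D : Derivation R S S)
    (M : Matrix ι ι S) : D M.det ∈ adjIdeal M := by
  rw [derivation_det]
  refine Ideal.sum_mem _ fun r _ => ?_
  rw [det_updateRow_eq_sum_mul_adjugate]
  exact Ideal.sum_mem _ fun c _ => Ideal.mul_mem_left _ _ (adjugate_mem_adjIdeal M c r)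

/-- `rank a ≤ n - 2 ⇒ adj a = 0` over a field (all `(n-1)`-minors vanish), i.e.
`{a : rank a ≤ n-2} ⊆ {a : ∀ i j, det a(i|j) = 0}` (vzG §2 states equality). [cite: Vonzurgathen1987, §2] -/
theorem adjugate_eq_zero_of_rank_lt {F : Type*} [Field F] {n : ℕ} {M : Matrix (Fin n) (Fin n) F}
    (h : M.rank + 1 < n) : M.adjugate = 0 := by
  cases n with
  | zero => exact absurd h (by omega)
  | succ k =>
    ext i j
    rw [Matrix.adjugate_fin_succ_eq_det_submatrix, Matrix.zero_apply]
    have hdet : (M.submatrix j.succAbove i.succAbove).det = 0 := by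
      by_contra hd
      have hU : IsUnit (M.submatrix j.succAbove i.succAbove) :=
        (Matrix.isUnit_iff_isUnit_det _).2 (isUnit_iff_ne_zero.2 hd)
      have hr := Matrix.rank_of_isUnit _ hU
      have hle := Matrix.rank_submatrix_le M j.succAbove i.succAbove
      rw [hr, Fintype.card_fin] at hle
      omega
    rw [hdet, mul_zero]

end AdjIdeal

/-! ### The singular locus of the permanent hypersurface -/

section SingPerm

/-- The ideal of `K[x_ij]` generated by `per_m` and its `m²` partial derivatives
`∂ per_m/∂x_ij = per x(i|j)`; its zero set is vzG's `sing P_m` (`P_m = {per = 0}`; §2: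
`sing Y = {a ∈ Y : ∂f/∂y_i (a) = 0 ∀ i}` for `Y = {f = 0}`). [cite: Vonzurgathen1987, §2] -/
def singPermIdeal (K : Type*) [CommRing K] (m : ℕ) : Ideal (MvPolynomial (Fin m × Fin m) K) :=
  Ideal.span (insert (perPoly (Fin m) K)
    (Set.range fun ij : Fin m × Fin m => pderiv ij (perPoly (Fin m) K)))

/-- `per_m ∈ singPermIdeal`. [cite: Vonzurgathen1987, §2] -/
theorem perPoly_mem_singPermIdeal (K : Type*) [CommRing K] (m : ℕ) :
    perPoly (Fin m) K ∈ singPermIdeal K m :=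
  Ideal.subset_span (Set.mem_insert _ _)

/-- `∂ per_m/∂x_ij ∈ singPermIdeal`. [cite: Vonzurgathen1987, §2] -/
theorem pderiv_perPoly_mem_singPermIdeal (K : Type*) [CommRing K] (m : ℕ) (ij : Fin m × Fin m) :
    pderiv ij (perPoly (Fin m) K) ∈ singPermIdeal K m :=
  Ideal.subset_span (Set.mem_insert_of_mem _ ⟨ij, rfl⟩)

/-- **Step 1, conclusion** (`S = Ã⁻¹(sing D_n) ⊆ sing P_m`, vzG p. 94), as an inclusion of ideals:
if `det B = per_m` (`B` of size `n ≥ 1`) then `singPermIdeal ≤ I_{n-1}(B)`. [cite: Vonzurgathen1987, proof of Thm. 3.1] -/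
theorem singPermIdeal_le_adjIdeal {K : Type*} [CommRing K] {m n : ℕ} (hn : 0 < n)
    (B : Matrix (Fin n) (Fin n) (MvPolynomial (Fin m × Fin m) K))
    (hdet : B.det = perPoly (Fin m) K) : singPermIdeal K m ≤ adjIdeal B := by
  haveI : Nonempty (Fin n) := ⟨⟨0, hn⟩⟩
  rw [singPermIdeal, Ideal.span_le]
  rintro f hf
  rcases hf with rfl | ⟨ij, rfl⟩
  · rw [SetLike.mem_coe, ← hdet]
    exact det_mem_adjIdeal B
  · rw [SetLike.mem_coe, ← hdet]
    exact derivation_det_mem_adjIdeal (pderiv ij) B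

end SingPerm

/-! ### The two dimension-theoretic inputs, as named facts (height form) -/

section Facts

/-- NAMED FACT (**von zur Gathen 1987, Lemma 2.1 with the theorem on the dimension of fibres, as
used in the proof of Thm. 3.1, p. 94**: for `F` algebraically closed and a polynomial map
`f : F^{k×k} → F^{n×n}`, "if `S = f⁻¹(sing D_n) ≠ ∅`, then `dim S ≥ k² - n² + (n² - 4) = k² - 4`
by Lemma 2.1 [`sing D_n = {rank ≤ n-2}` is irreducible of dimension `n² - 4`, `n ≥ 2`] and
the theorem on the dimension of fibres").  Height form, via the dictionary of the module docstring
(`S = V(adjIdeal f)`; `S ≠ ∅ ↔ adjIdeal f ≠ ⊤`; `dim S = k² - min height` over the minimal primes):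
if the `(n-1)`-minors of an `n × n` matrix (`n ≥ 2`) of polynomials in the `k²` variables over an
algebraically closed field generate a proper ideal, then some minimal prime over that ideal has
height `≤ 4`.  (This is also the case `t = n - 1` of the Eagon–Northcott bound
`height I_t ≤ (n-t+1)²` for determinantal ideals, valid over any noetherian ring.)  Users take
`(h : vonzurGathen1987_submaximalMinors_height)`; the fact is DISCHARGED in the sibling file
`VonZurGathenRegularityProofs.lean` (`vonzurGathen1987_submaximalMinors_height_holds`, Eagon's
theorem for submaximal minors, Matsumura CRT Thm. 13.10), which feeds `h`.
[cite: Vonzurgathen1987, Lemma 2.1 and proof of Thm. 3.1] -/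
def vonzurGathen1987_submaximalMinors_height : Prop :=
  ∀ (K : Type) [Field K] [IsAlgClosed K] (k n : ℕ), 2 ≤ n →
    ∀ B : Matrix (Fin n) (Fin n) (MvPolynomial (Fin k × Fin k) K), adjIdeal B ≠ ⊤ →
      ∃ P ∈ (adjIdeal B).minimalPrimes, P.height ≤ 4

/-- NAMED FACT (**von zur Gathen 1987, Lemma 2.3**: "Let `n ≥ 3`, and `F` be algebraically closed
[of characteristic different from two, §2]. Then every irreducible component of `sing P_n` has
dimension at most `n² - 5`").  Height form, via the dictionary of the module docstring (the
components of `sing P_m = V(singPermIdeal)` are the `V(P)`, `P` a minimal prime of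
`singPermIdeal`, of dimension `m² - height P`; heights are monotone): every prime ideal of
`K[x_ij]` containing `per_m` and all `∂ per_m/∂x_ij` has height `≥ 5`.  The printed proof is an
explicit induction on `m` (four coordinates are algebraic over the others on each component, plus
one more relation `h`) and is not vendored; users take `(h : vonzurGathen1987_singPerm_height)`.
[cite: Vonzurgathen1987, Lemma 2.3] -/
def vonzurGathen1987_singPerm_height : Prop :=
  ∀ (K : Type) [Field K] [IsAlgClosed K], (2 : K) ≠ 0 → ∀ m : ℕ, 3 ≤ m →
    ∀ P : Ideal (MvPolynomial (Fin m × Fin m) K), P.IsPrime → singPermIdeal K m ≤ P →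
      (5 : ℕ∞) ≤ P.height

end Facts

/-! ### Assembly: Thm. 3.1 from the two facts -/

section Assembly

/-- `eval (φ ∘ v) (map φ p) = φ (eval v p)` (base change of an evaluation). [folklore] -/
theorem eval_comp_map {R S σ : Type*} [CommSemiring R] [CommSemiring S] (φ : R →+* S)
    (v : σ → R) (p : MvPolynomial σ R) :
    MvPolynomial.eval (φ ∘ v) (MvPolynomial.map φ p) = φ (MvPolynomial.eval v p) := by
  rw [MvPolynomial.eval_map, show MvPolynomial.eval v p = eval₂ (RingHom.id R) v p from rfl,
    MvPolynomial.eval₂_comp_left, RingHom.comp_id]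

/-- **The core of vzG's proof of Thm. 3.1 over an algebraically closed field** (p. 94): granted the
two facts, a matrix of polynomials `B` with `det B = per_m` (`m ≥ 3`, `char ≠ 2`) has no point `w`
at which all `(n-1)`-minors vanish. [cite: Vonzurgathen1987, Thm. 3.1] -/
theorem false_of_adjugate_eval_eq_zero (h2 : vonzurGathen1987_submaximalMinors_height)
    (h3 : vonzurGathen1987_singPerm_height) {K : Type} [Field K] [IsAlgClosed K]
    (h2K : (2 : K) ≠ 0) {m : ℕ} (hm : 3 ≤ m) {n : ℕ}
    {B : Matrix (Fin n) (Fin n) (MvPolynomial (Fin m × Fin m) K)}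
    (hdet : B.det = perPoly (Fin m) K) {w : Fin m × Fin m → K}
    (hw : B.adjugate.map (MvPolynomial.eval w) = 0) : False := by
  rcases Nat.lt_or_ge n 2 with hn | hn
  · interval_cases n
    · -- `n = 0`: `det B = 1 ≠ per_m`
      have h0 := constantCoeff_perPoly K (show 1 ≤ m by omega)
      rw [← hdet, Matrix.det_isEmpty, map_one] at h0
      exact one_ne_zero h0
    · -- `n = 1`: `adj B = 1` does not vanish anywhere
      have h1 := congrFun (congrFun hw 0) 0
      rw [Matrix.adjugate_subsingleton, Matrix.map_apply, Matrix.one_apply_eq, map_one,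
        Matrix.zero_apply] at h1
      exact one_ne_zero h1
  · have hle : adjIdeal B ≤ RingHom.ker (MvPolynomial.eval w) := by
      rw [adjIdeal, Ideal.span_le]
      rintro _ ⟨p, rfl⟩
      rw [SetLike.mem_coe, RingHom.mem_ker]
      have := congrFun (congrFun hw p.1) p.2
      rwa [Matrix.map_apply, Matrix.zero_apply] at this
    have hne : adjIdeal B ≠ ⊤ := fun htop =>
      RingHom.ker_ne_top (MvPolynomial.eval w) (top_le_iff.1 (htop ▸ hle))
    obtain ⟨P, hP, hP4⟩ := h2 K m n hn B hne
    have h5 : (5 : ℕ∞) ≤ P.height :=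
      h3 K h2K m hm P hP.1.1 ((singPermIdeal_le_adjIdeal (by omega) B hdet).trans hP.1.2)
    have h54 : (5 : ℕ∞) ≤ 4 := h5.trans hP4
    exact absurd h54 (by decide)

/-- **von zur Gathen 1987, Thm. 3.1, from the two height facts**: the tree's named fact
`vonzurGathen1987_perm_detRepr_rank` (every polynomial determinantal representation of `per_m`,
`m ≥ 3`, over an infinite field of characteristic `≠ 2`, has rank `≥ n - 1` at every point)
follows from `vonzurGathen1987_submaximalMinors_height` and `vonzurGathen1987_singPerm_height`
by step 1 and base change to an algebraic closure (vzG p. 94, last paragraph of the proof).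
[cite: Vonzurgathen1987, Thm. 3.1] -/
theorem vonzurGathen1987_perm_detRepr_rank_of_height_facts
    (h2 : vonzurGathen1987_submaximalMinors_height) (h3 : vonzurGathen1987_singPerm_height) :
    vonzurGathen1987_perm_detRepr_rank := by
  intro F _ _ h2F m hm n A hdet v
  by_contra hlt
  push Not at hlt
  have hadj : (A.map (MvPolynomial.eval v)).adjugate = 0 := adjugate_eq_zero_of_rank_lt hlt
  -- base change to an algebraic closure `K` of `F`
  let K := AlgebraicClosure F
  let φ : F →+* K := algebraMap F K
  let B : Matrix (Fin n) (Fin n) (MvPolynomial (Fin m × Fin m) K) := A.map (MvPolynomial.map φ)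
  have hdetB : B.det = perPoly (Fin m) K := by
    show ((MvPolynomial.map φ).mapMatrix A).det = _
    rw [← RingHom.map_det, hdet, map_perPoly]
  have h2K : (2 : K) ≠ 0 := by
    intro h
    apply h2F
    apply φ.injective
    rw [map_ofNat, h, map_zero]
  have hw : B.adjugate.map (MvPolynomial.eval (φ ∘ v)) = 0 := by
    have hB : B.adjugate = A.adjugate.map (MvPolynomial.map φ) := by
      show ((MvPolynomial.map φ).mapMatrix A).adjugate = _
      rw [← RingHom.map_adjugate]
      rfl
    have hA : (A.map (MvPolynomial.eval v)).adjugate = A.adjugate.map (MvPolynomial.eval v) := by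
      show ((MvPolynomial.eval v).mapMatrix A).adjugate = _
      rw [← RingHom.map_adjugate]
      rfl
    ext i j
    have hij := congrFun (congrFun hadj i) j
    rw [hA, Matrix.map_apply, Matrix.zero_apply] at hij
    rw [Matrix.map_apply, hB, Matrix.map_apply, eval_comp_map, hij, map_zero, Matrix.zero_apply]
  exact false_of_adjugate_eval_eq_zero h2 h3 h2K hm hdetB hw

end Assembly

end VonZurGathen

end Literature.Computability.AlgebraicComplexity
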